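import Literature.NumberTheory.Automorphic.AsaiSign
import Literature.NumberTheory.GaloisRepresentations.ArtinCharacterReciprocity
import Literature.NumberTheory.GaloisRepresentations.IntegralGaloisActionProofs
import HarnessLib

/-!
# Partial Asai `L`-functions twisted by a character of the base field, and their pole at `s = 1`

Topic `NumberTheory/Automorphic`; namespace `Literature.NumberTheory.Automorphic`. Definition
request `defn-AutomorphicRepData.HasTwistedAsaiPole` (crux `QuadraticWindow.HostInducedRep`,
line `generic-descent-without-endoscopy` / cards `one-transparent-pane`,
`flicker-period-sign-pin`): the vocabulary of the accepted `AsaiSign`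
(`asaiLocalPolynomial`, `partialAsaiL`, `IsAsaiDatum`, `HasAsaiPole`, `HasAsaiSign`) extended by a
**twist by a character `μ` of the base field `F`**.

**Setting** (as in `AsaiSign`). `E / F` is an extension of number fields with an automorphism
`c : E ≃ₐ[F] E` (quadratic with `c ≠ 1` in the facts; never a hypothesis of the definitions),
`A : SatakeFamily E` a family of candidate Satake parameters, `η : ℤˣ` the Asai sign (`As^η`),
`S` a set of finite places of `F`, `q_v = v.residueCard`. The character `μ` of
`F^× \ 𝔸_F^×` enters **only through its values `m_v = μ_v(ϖ_v) ∈ ℂ` at uniformizers of the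
finite places `v` outside its ramification** — a *value family*
`m : HeightOneSpectrum (𝓞 F) → ℂ` together with an exceptional set `T ⊇ ram(μ)` off which the
values are meaningful. Three currencies for `μ` are served:

* a bare value family `(T, m)` (any quasi-character, e.g. `m_v = χ(ϖ_v) q_v^{k}` for an algebraic
  Hecke character `χ ‖·‖^{-k}` of a totally real field);
* an **Artin avatar** `μ : FramedGaloisRep F ℂ 1` (a continuous character `Γ_F → GL_1(ℂ)`, the
  currency of the route `Langlands/QuadraticWindow`): `m` is a *Frobenius-value datum* of `μ` off
  `T` when `μ` is unramified at every `v ∉ T` with `μ.HasFrobCharpolyAt v (X - C (m v))`, i.e.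
  `m_v = μ(Frob_v)` for the **arithmetic** Frobenius (`FramedGaloisRep.IsFrobValueDatum`);
* a **Hecke character** `χ : HeckeCharacter F` of the accepted `HeckeCharacter`
  (`m = χ.valueAtUniformizer`, `T = χ.ramifiedPlaces`).

By Artin reciprocity in the tree's (Tate's) normalisation (`artinReciprocity_character`:
`ω(ϖ_v) = χ(Frob_v^{arith})`) the Artin and Hecke currencies agree: a Frobenius-value datum of
`μ` is the value family of the finite-order Hecke character `ω_μ = μ ∘ ψ_{L/F}`. Authors who
normalise the Artin map by *geometric* Frobenius attach to the same Euler product the name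
`L^S(s, π, As^η ⊗ ω_μ⁻¹)`; the definitions below are stated on values and are insensitive to this.

**The twisted partial Asai `L`-function.** For `v ∉ S` with chosen place `w_v = placeAbove E v`,
`det(1 - m_v As^η(t_v) q_v^{-s}) = (asaiLocalPolynomial c A η w_v)(m_v q_v^{-s})`, so
`L^S(s, A, As^η ⊗ μ) := ∏'_{v ∉ S} (asaiLocalPolynomial c A η w_v)(m_v q_v^{-s})⁻¹`
(`partialAsaiLTwist S c A m η s`) — Flicker's partial twisted tensor Euler product
`L(s, r(π), V) = ∏_{v ∉ V} det[1 - q_v^{-s} r(t_v)]⁻¹` (1988, p. 296) for the representation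
`r ⊗ μ` of the `L`-group of `Res_{E/F} GL_N` (`μ` a character of `W_F` through `W_F^{ab} = C_F`),
equivalently the partial `L`-function `L^S(s, π ⊗ μ̃, As^η)` of the twist of `π` by any Hecke
character `μ̃` of `E` with `μ̃|_{𝔸_F^×} = μ` (**proved** here on Satake data:
`partialAsaiL_twist_eq_partialAsaiLTwist`; this is Flicker's device "we can replace `π` by its
product with an unramified character", p. 296, and Mok's "`L(s, φ ⊗ χ_-, As⁺) = L(s, φ, As⁻)`" for
`χ_- |_{𝔸_F^×} = ω_{E/F}`, §2.5 p. 20; Gan–Gross–Prasad §7: `As⁻ = As⁺ ⊗ ω_{E/F}`).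

**Contents.**

* Polynomial identities (**proved**, folklore): `eulerPolynomial_map_mul`
  (`∏ (1 - u a X) = (∏ (1 - a X)) ∘ (u X)`), `satakePairPolynomial_map_mul_map_mul_eq_comp`
  (`det(1 - u t ⊗ u' t' X) = det(1 - t ⊗ t' X) ∘ (u u' X)`; its `eval` form is the accepted
  `eval_satakePairPolynomial_map_mul_map_mul` of `PairLFunctionPolesRepData`, not imported),
  `asaiInertPolynomial_map_mul_eq_comp`
  (`P^η({u αᵢ}) = P^η(α) ∘ (u X)`: at an inert place the twist by `μ̃_w(ϖ_v) = u` is the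
  substitution `X ↦ u X`), its `eval` form `eval_asaiInertPolynomial_map_mul`, and
  `eval_asaiInertPolynomial_units_mul` (`P^η(α)(ε x) = P^{ε η}(α)(x)`, `ε = ±1`).
* `asaiLocalPolynomial_twist_of_smul_eq` / `_of_smul_ne` (**proved**): the local Asai polynomial of
  the twisted family `w ↦ {μ̃_w αᵢ}` is the old one composed with `X ↦ μ̃_w(ϖ_v) X` at a `c`-fixed
  `w` and with `X ↦ μ̃_w(ϖ_v) μ̃_{c • w}(ϖ_v) X` at a `c`-moved `w` — i.e. with `X ↦ μ̃|_{F_v^×}(ϖ_v) X`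
  in both cases.
* `partialAsaiLTwist S c A m η s` (**definition**), with `partialAsaiLTwist_congr`,
  `partialAsaiLTwist_one` (`m = 1` gives `partialAsaiL`), `partialAsaiLTwist_eq_tprod` (independence
  of the places chosen above `v`, `[E : F] = 2`, `c ≠ 1`), `partialAsaiL_twist_eq_partialAsaiLTwist`
  (`L^S(s, A ⊗ μ̃, As^η) = L^S(s, A, As^η ⊗ μ̃|_F)`), and `partialAsaiLTwist_quadraticSign`
  (`m_v = -1` at inert, `+1` at split `v ∉ S` gives `L^S(s, A, As^{-η})`: `As^η ⊗ ω_{E/F} = As^{-η}`).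
* Predicates on an automorphic representation datum `π` of `GL_N(𝔸_E)`:
  `HasAsaiPoleTwistedBy π c T m η` (value currency: for every Asai datum `(S, A)` of `π` with
  `T ⊆ S`, `(s - 1) L^S(s, π, As^η ⊗ m) → r ≠ 0` as `s → 1`, `Re s > 1`),
  `HasTwistedAsaiPole π c μ η` (Artin currency, the requested notion: for every Asai datum `(S, A)`
  and every Frobenius-value datum `m` of `μ` off `S`, the same), and
  `HasHeckeTwistedAsaiPole π c χ η` (Hecke currency); the dictionary lemmas
  `hasTwistedAsaiPole_iff` (Artin = value currency over Frobenius data),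
  `hasTwistedAsaiPole_one_iff` (**`μ = 1` recovers `HasAsaiPole`**, using the existence of Frobenius
  elements `exists_isArithFrobAt_of_mem_primesAbove_holds`), `HasAsaiPole.hasAsaiPoleTwistedBy_one`,
  and `HasAsaiPole.hasAsaiPoleTwistedBy_quadraticSign` (a pole of `As^{-η}` is a pole of
  `As^η ⊗ ω_{E/F}`).
* `FramedGaloisRep.IsFrobValueDatum μ T m` (**definition**, declared by its absolute name in the
  namespace of the accepted `FramedGaloisRep`) with `mono`, `isUnramifiedAt`, `hasFrobCharpolyAt`,
  `apply_eq` (uniqueness of the value at `v ∉ T`) and `isFrobValueDatum_one`.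

**Why these objects** (recorded, not used): for a cuspidal `π` on `GL_n(𝔸_F)`, `F / F₀`
quadratic with automorphism `τ`, polarised as `π^τ ≅ π^∨ ⊗ (η ∘ N_{F/F₀} ∘ det)` for a Hecke
character `η` of `F₀`, `L^S(s, π × π^τ ⊗ (η ∘ N ∘ det)⁻¹) = L^S(s, π × π^∨)` has a simple pole at
`s = 1` (Jacquet–Shalika), and at the unramified places it factors as
`L^S(s, π, As⁺ ⊗ η⁻¹) · L^S(s, π, As⁻ ⊗ η⁻¹)` (the accepted `asaiInertPolynomial_one_mul_neg_one` /
`partialPairL_smul_eq_partialAsaiL_mul` of `AsaiSign` composed with the substitution `X ↦ m_v X`,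
`m_v = η_v(ϖ_v)⁻¹`); granted non-vanishing of the two factors on `Re s = 1`, exactly one twisted
Asai `L`-function has the pole — the sign in which the archimedean sign law of the crux is a
statement. Flicker's theorem (1988, p. 297: for cuspidal `π` with central character trivial on
`𝔸_F^×`, the partial twisted tensor `L`-function has a pole at `s = 1` iff `π` is
`GL_n(𝔸_F)`-distinguished) and its twisted forms are **not** vendored here (no named fact in this
file).

## Design notes

* Value families are total functions `m : HeightOneSpectrum (𝓞 F) → ℂ`; the exceptional set `T`
  of `HasAsaiPoleTwistedBy` says where they are meaningful (for `T` infinite the predicate is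
  vacuous — no Asai datum `(S, A)`, `S` finite, contains `T` —, exactly as `HasAsaiPole` is vacuous
  for a `π` without Asai data; intended use: `T` = the finite ramification locus of `μ`).
* `IsFrobValueDatum` asks for `μ.IsUnramifiedAt v` **and** `μ.HasFrobCharpolyAt v (X - C (m v))`
  off `T`, the pair of clauses carried by the route `QuadraticWindow` (for rank one the second
  implies the first, since Frobenius elements at `𝔓` form a coset of the inertia group; not used).
* As in `AsaiSign`, poles are simple poles approached from `Re s > 1`
  (`(s - 1) L(s) → r ≠ 0` along `𝓝[{s | 1 < re s}] 1`), products are unconditional `tprod`s with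
  junk value `1` where not multipliable, and the predicates quantify over **all** data (two data
  differ at finitely many unramified places, whose local factors are finite and non-zero at
  `s = 1` for genuine `π` and unitary `μ` by the Jacquet–Shalika bounds).
* No new named fact (`def … : Prop` without proof obligations) is introduced; everything stated
  as a `theorem` is proved. `F E : Type` (forced by `SatakeFamily`, `AutomorphicRepData`).
* Mathlib / tree search: Mathlib has no Asai representation or automorphic `L`-function
  (`Asai`, `twisted tensor`: nothing); the tree has the untwisted objects (`AsaiSign`), rank-one
  Frobenius values (`FramedGaloisRep.hasFrobCharpolyAt_iff_of_rank_one`,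
  `ArtinCharacterReciprocity`), Hecke characters (`HeckeCharacter.valueAtUniformizer`,
  `ramifiedPlaces`) and the quadratic sign `quadraticSign` / `quadraticArtinChar`
  (`QuadraticCharacterTwist`, not imported: heavy import chain; `partialAsaiLTwist_quadraticSign` is
  stated on values `±1` directly). Reused, not redefined: `asaiLocalPolynomial`, `partialAsaiL`,
  `placeAbove`, `IsAsaiDatum`, `HasAsaiPole`, `satakeTensor_comm`, `satakeTensor_map_mul_right`,
  `asaiInertPolynomial_map_mul`, `HeightOneSpectrum.eq_or_eq_smul_of_under_eq`.

## References

* Y. Z. Flicker, *Twisted tensors and Euler products*, Bull. Soc. Math. France 116 (1988),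
  295–313: p. 296 (the partial Euler product `L(s, r(π), V)`, the twisted tensor representation
  `r`, and the reduction "replace `π` by its product with an unramified character"), Theorem p. 297.
  [Flicker1988]
* W. T. Gan, B. H. Gross, D. Prasad, *Symplectic local root numbers, central critical `L`-values,
  and restriction problems in the representation theory of classical groups*, Astérisque 346
  (2012), §7 (`As^±`, "`As⁻(M)` is the twist of `As⁺(M)` by the quadratic character `ω_{k/k₀}`"),
  §25 (b). [GanGrossPrasad2012]
* C. P. Mok, *Endoscopic classification of representations of quasi-split unitary groups*,
  Mem. Amer. Math. Soc. 235 (2015), §2.5 (p. 20: `L(s, φ ⊗ χ, Asai)`, `χ ∈ 𝒵_E^-`), Thm. 2.5.4 (a).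
  [Mok2014]
* F. Shahidi, *On certain `L`-functions*, Amer. J. Math. 103 (1981), Thm. 5.1. [ShahidiAJM1981]
* J. Tate, *Global class field theory*, Ch. VII of Cassels–Fröhlich (1967), §2.1, §4.2 (the
  arithmetic normalisation `ω(ϖ_v) = χ(Frob_v)`). [CasselsFrohlichANT1967]
-/

noncomputable section

open scoped MatrixGroups Topology Classical
open NumberField IsDedekindDomain Polynomial Filter
open Literature.NumberTheory.GaloisRepresentations

namespace Literature.NumberTheory.Automorphic

/-! ### Twisting Euler, Rankin–Selberg and inert Asai polynomials: `X ↦ u X` -/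

section LocalTwist

/-- **Twisting an Euler polynomial is a substitution**:
`∏_{a ∈ s} (1 - (u a) X) = (∏_{a ∈ s} (1 - a X)) ∘ (u X)` — the unramified `L`-factor of
`Π_v ⊗ χ_v` with `χ_v(ϖ_v) = u` is `L(s, Π_v)` with `q_v^{-s}` replaced by `u q_v^{-s}`. [folklore] -/
theorem eulerPolynomial_map_mul (u : ℂ) (s : Multiset ℂ) :
    eulerPolynomial (s.map (u * ·)) = (eulerPolynomial s).comp (C u * X) := by
  induction s using Multiset.induction_on with
  | empty => simp
  | cons a s ih =>
    rw [Multiset.map_cons, eulerPolynomial_cons, eulerPolynomial_cons, ih, mul_comp]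
    congr 1
    simp only [sub_comp, one_comp, mul_comp, C_comp, X_comp, C_mul]
    ring

/-- **Twisting a pair by scalars `u`, `u'` is the substitution `X ↦ u u' X`**:
`∏_{i,j} (1 - (u αᵢ)(u' βⱼ) X) = (∏_{i,j} (1 - αᵢ βⱼ X)) ∘ (u u' X)`. At a place `v` of `F` split
in `E`, `v = w w̄`, twisting `Π` by a Hecke character `μ̃` of `E` multiplies `Sat(Π, w)` by
`u = μ̃_w(ϖ_v)` and `Sat(Π, w̄)` by `u' = μ̃_{w̄}(ϖ_v)`, and `u u' = μ̃|_{F_v^×}(ϖ_v)`: the split Asai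
factor of `Π ⊗ μ̃` is that of `Π` twisted by `μ̃|_{𝔸_F^×}` (generalises the accepted
`satakePairPolynomial_map_mul_map_mul`, the case `u u' = 1`). [folklore] -/
theorem satakePairPolynomial_map_mul_map_mul_eq_comp (u u' : ℂ) (α β : Multiset ℂ) :
    satakePairPolynomial (α.map (u * ·)) (β.map (u' * ·)) =
      (satakePairPolynomial α β).comp (C (u * u') * X) := by
  rw [satakePairPolynomial_eq_eulerPolynomial, satakePairPolynomial_eq_eulerPolynomial,
    satakeTensor_map_mul_right, satakeTensor_comm, satakeTensor_map_mul_right, satakeTensor_comm,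
    Multiset.map_map, ← eulerPolynomial_map_mul]
  congr 1
  refine Multiset.map_congr rfl fun x _ => ?_
  simp only [Function.comp_apply]
  ring

/-- **Twisting rule at an inert place, general scalar**: multiplying all Satake parameters by `u`
composes the inert Asai polynomial with `X ↦ u X`,
`P^η({u αᵢ}) = ∏ᵢ (1 - η u αᵢ X) ∏_{i<j} (1 - u² αᵢ αⱼ X²) = P^η(α) ∘ (u X)`. For a Hecke character
`μ̃` of `E` unramified at the inert `w | v`, `u = μ̃_w(ϖ_v) = μ̃|_{F_v^×}(ϖ_v)` (`ϖ_v` is a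
uniformizer of `E_w`): the inert Asai factor of `Π ⊗ μ̃` is that of `Π` twisted by `μ̃|_{𝔸_F^×}`
(generalises the accepted `asaiInertPolynomial_map_mul`, the case `u = ±1`; Mok, §2.5, p. 20,
"`L(s, φ ⊗ χ, Asai)` … is independent of the choice of `χ ∈ 𝒵_E^-`"). [folklore] -/
theorem asaiInertPolynomial_map_mul_eq_comp (η : ℤˣ) (u : ℂ) (α : Multiset ℂ) :
    asaiInertPolynomial η (α.map (u * ·)) = (asaiInertPolynomial η α).comp (C u * X) := by
  induction α using Multiset.induction_on with
  | empty => simp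
  | cons a α ih =>
    rw [Multiset.map_cons, asaiInertPolynomial_cons, asaiInertPolynomial_cons, ih, mul_comp,
      mul_comp, multiset_prod_comp, Multiset.map_map, Multiset.map_map]
    congr 2
    · simp only [sub_comp, one_comp, mul_comp, C_comp, X_comp, C_mul]
      ring
    · refine congrArg Multiset.prod (Multiset.map_congr rfl fun b _ => ?_)
      simp only [Function.comp_apply, sub_comp, one_comp, mul_comp, C_comp, pow_comp, X_comp, C_mul]
      ring

/-- Evaluated form: `P^η({u αᵢ})(x) = P^η(α)(u x)`. [folklore] -/
theorem eval_asaiInertPolynomial_map_mul (η : ℤˣ) (u : ℂ) (α : Multiset ℂ) (x : ℂ) :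
    (asaiInertPolynomial η (α.map (u * ·))).eval x = (asaiInertPolynomial η α).eval (u * x) := by
  rw [asaiInertPolynomial_map_mul_eq_comp, eval_comp, eval_mul, eval_C, eval_X]

/-- **Twisting by a sign swaps the Asai sign at an inert place**, evaluated form:
`P^η(α)(ε x) = P^{ε η}(α)(x)` for `ε = ±1` — the value `ω_{E/F}(ϖ_v) = -1` of the quadratic
character at an inert `v` turns the `As^η`-factor into the `As^{-η}`-factor
(`As⁻ = As⁺ ⊗ ω_{E/F}`, Gan–Gross–Prasad §7; from the accepted `asaiInertPolynomial_map_mul`).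
[cite: GanGrossPrasad2012, §7] -/
theorem eval_asaiInertPolynomial_units_mul (η ε : ℤˣ) (α : Multiset ℂ) (x : ℂ) :
    (asaiInertPolynomial η α).eval (((ε : ℤ) : ℂ) * x) = (asaiInertPolynomial (ε * η) α).eval x := by
  rw [← eval_asaiInertPolynomial_map_mul, asaiInertPolynomial_map_mul]

end LocalTwist

/-! ### The local Asai polynomial of a twisted Satake family -/

section Places

variable {F E : Type} [Field F] [Field E] [Algebra F E]

/-- **The local Asai polynomial of a twisted family at a `c`-fixed place.** For a Satake family `A`
over `E` and scalars `t w` (the values `μ̃_w(ϖ)` of an unramified character of `E_w`), the family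
`w ↦ {t_w αᵢ}` of `Π ⊗ μ̃` has, at a place `w` with `c • w = w` (inert), local Asai polynomial
`(asaiLocalPolynomial c A η w) ∘ (t_w X)`. [folklore] -/
theorem asaiLocalPolynomial_twist_of_smul_eq {c : E ≃ₐ[F] E} (A : SatakeFamily E)
    (t : HeightOneSpectrum (𝓞 E) → ℂ) (η : ℤˣ) {w : HeightOneSpectrum (𝓞 E)} (hw : c • w = w) :
    asaiLocalPolynomial c (fun w => (A w).map (t w * ·)) η w =
      (asaiLocalPolynomial c A η w).comp (C (t w) * X) := by
  rw [asaiLocalPolynomial_of_smul_eq _ η hw, asaiLocalPolynomial_of_smul_eq A η hw,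
    asaiInertPolynomial_map_mul_eq_comp]

/-- **The local Asai polynomial of a twisted family at a `c`-moved place.** At a place `w` with
`c • w ≠ w` (split, `v = w · (c • w)`), the family `w ↦ {t_w αᵢ}` has local Asai polynomial
`(asaiLocalPolynomial c A η w) ∘ (t_w t_{c • w} X)` — the twist by
`μ̃|_{F_v^×}(ϖ_v) = μ̃_w(ϖ_v) μ̃_{c • w}(ϖ_v)`. [folklore] -/
theorem asaiLocalPolynomial_twist_of_smul_ne {c : E ≃ₐ[F] E} (A : SatakeFamily E)
    (t : HeightOneSpectrum (𝓞 E) → ℂ) (η : ℤˣ) {w : HeightOneSpectrum (𝓞 E)} (hw : c • w ≠ w) :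
    asaiLocalPolynomial c (fun w => (A w).map (t w * ·)) η w =
      (asaiLocalPolynomial c A η w).comp (C (t w * t (c • w)) * X) := by
  rw [asaiLocalPolynomial_of_smul_ne _ η hw, asaiLocalPolynomial_of_smul_ne A η hw,
    satakePairPolynomial_map_mul_map_mul_eq_comp]

/-! ### The twisted partial Asai `L`-function -/

variable [NumberField F]

/-- The **partial Asai `L`-function of a Satake family `A` over `E`, twisted by a value family `m`
of the base field `F`**: for the conjugation `c`, the sign `η`, a set `S` of finite places of `F`
and `m : v ↦ m_v ∈ ℂ` (the values `μ_v(ϖ_v)` of a character `μ` of `F^× \ 𝔸_F^×` unramified off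
`S`; for an Artin avatar `μ : Γ_F → GL_1(ℂ)`, its arithmetic-Frobenius values,
`FramedGaloisRep.IsFrobValueDatum`),
`L^S(s, A, As^η ⊗ μ) = ∏'_{v ∉ S} (asaiLocalPolynomial c A η w_v)(m_v q_v^{-s})⁻¹`
`= ∏_{v ∉ S} det(1 - m_v As^η(t_v) q_v^{-s})⁻¹`
with `w_v = placeAbove E v` and `q_v = v.residueCard`: Flicker's partial twisted tensor Euler
product `∏_{v ∉ V} det[1 - q_v^{-s} r(t_v)]⁻¹` (p. 296) for `r ⊗ μ`, i.e. the accepted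
`partialAsaiL` with the substitution `X ↦ m_v X` in each local factor; equal to the untwisted
partial Asai `L`-function of the twisted family `A ⊗ μ̃` for any character `μ̃` of `E` restricting
to `μ` (`partialAsaiL_twist_eq_partialAsaiLTwist`). An unconditional `tprod` over `{v // v ∉ S}`
(genuine value where multipliable — `Re s > 1` for unitary cuspidal data and unitary `μ` —, junk
value `1` elsewhere), exactly like `partialAsaiL`; poles at `s = 1` are expressed through limits
from `Re s > 1` (`AutomorphicRepData.HasAsaiPoleTwistedBy`). [cite: Flicker1988, p. 296] -/
def partialAsaiLTwist (S : Set (HeightOneSpectrum (𝓞 F))) (c : E ≃ₐ[F] E) (A : SatakeFamily E)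
    (m : HeightOneSpectrum (𝓞 F) → ℂ) (η : ℤˣ) (s : ℂ) : ℂ :=
  ∏' v : {v : HeightOneSpectrum (𝓞 F) // v ∉ S},
    ((asaiLocalPolynomial c A η (placeAbove E v.1)).eval (m v.1 * (v.1.residueCard : ℂ) ^ (-s)))⁻¹

/-- The twisted partial Asai `L`-function only sees the values `m_v` for `v ∉ S`. [folklore] -/
theorem partialAsaiLTwist_congr {S : Set (HeightOneSpectrum (𝓞 F))} (c : E ≃ₐ[F] E)
    (A : SatakeFamily E) {m m' : HeightOneSpectrum (𝓞 F) → ℂ} (h : ∀ v ∉ S, m v = m' v) (η : ℤˣ)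
    (s : ℂ) : partialAsaiLTwist S c A m η s = partialAsaiLTwist S c A m' η s := by
  unfold partialAsaiLTwist
  exact tprod_congr fun v => by rw [h v.1 v.2]

/-- **Trivial twist**: for the value family `m = 1` (the trivial character),
`L^S(s, A, As^η ⊗ 1) = L^S(s, A, As^η)` is the accepted `partialAsaiL`. [folklore] -/
@[simp]
theorem partialAsaiLTwist_one (S : Set (HeightOneSpectrum (𝓞 F))) (c : E ≃ₐ[F] E)
    (A : SatakeFamily E) (η : ℤˣ) (s : ℂ) :
    partialAsaiLTwist S c A 1 η s = partialAsaiL S c A η s := by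
  simp [partialAsaiLTwist, partialAsaiL]

/-- A value family equal to `1` off `S` twists nothing: `L^S(s, A, As^η ⊗ m) = L^S(s, A, As^η)`.
[folklore] -/
theorem partialAsaiLTwist_eq_partialAsaiL_of_eq_one {S : Set (HeightOneSpectrum (𝓞 F))}
    (c : E ≃ₐ[F] E) (A : SatakeFamily E) {m : HeightOneSpectrum (𝓞 F) → ℂ}
    (h : ∀ v ∉ S, m v = 1) (η : ℤˣ) (s : ℂ) :
    partialAsaiLTwist S c A m η s = partialAsaiL S c A η s := by
  rw [partialAsaiLTwist_congr c A (m' := 1) h, partialAsaiLTwist_one]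

/-- **`L^S(s, A ⊗ μ̃, As^η) = L^S(s, A, As^η ⊗ μ̃|_{𝔸_F^×})` on Satake data.** Let `t w` be scalars at
the places of `E` (the values `μ̃_w(ϖ)` of a Hecke character `μ̃` of `E` unramified above the
complement of `S`) and `m` a value family on `F` with `m_v = t_w` when the place `w` above
`v ∉ S` is `c`-fixed and `m_v = t_w t_{c • w}` when it is `c`-moved — the values
`μ̃|_{F_v^×}(ϖ_v)` of the restriction `μ = μ̃|_{𝔸_F^×}` (`ϖ_v` stays a uniformizer at an inert `w` and
`F_v^× ↪ E_w^× × E_{w̄}^×` diagonally at a split `v`). Then the (untwisted) partial Asai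
`L`-function of the twisted family `w ↦ {t_w αᵢ}` is the `m`-twisted partial Asai `L`-function of
`A`. This is the reduction "replace `π` by its product with a character" of Flicker (1988, p. 296)
and the identity behind Mok's "`L(s, φ^N ⊗ χ, Asai)` … `= L(s, φ^N, As⁻)`" for `χ|_{𝔸_F^×} = ω_{E/F}`
(§2.5, p. 20). [cite: Flicker1988, p. 296] [cite: Mok2014, §2.5] -/
theorem partialAsaiL_twist_eq_partialAsaiLTwist (S : Set (HeightOneSpectrum (𝓞 F)))
    (c : E ≃ₐ[F] E) (A : SatakeFamily E) (t : HeightOneSpectrum (𝓞 E) → ℂ)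
    {m : HeightOneSpectrum (𝓞 F) → ℂ}
    (hinert : ∀ w : HeightOneSpectrum (𝓞 E), w.under (𝓞 F) ∉ S → c • w = w →
      m (w.under (𝓞 F)) = t w)
    (hsplit : ∀ w : HeightOneSpectrum (𝓞 E), w.under (𝓞 F) ∉ S → c • w ≠ w →
      m (w.under (𝓞 F)) = t w * t (c • w))
    (η : ℤˣ) (s : ℂ) :
    partialAsaiL S c (fun w => (A w).map (t w * ·)) η s = partialAsaiLTwist S c A m η s := by
  unfold partialAsaiL partialAsaiLTwist
  refine tprod_congr fun v => ?_
  have hv : (placeAbove E v.1).under (𝓞 F) ∉ S := by rw [placeAbove_under]; exact v.2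
  by_cases hw : c • placeAbove E v.1 = placeAbove E v.1
  · rw [asaiLocalPolynomial_twist_of_smul_eq A t η hw, eval_comp, eval_mul, eval_C, eval_X,
      ← hinert _ hv hw, placeAbove_under]
  · rw [asaiLocalPolynomial_twist_of_smul_ne A t η hw, eval_comp, eval_mul, eval_C, eval_X,
      ← hsplit _ hv hw, placeAbove_under]

/-- **`As^η ⊗ ω_{E/F} = As^{-η}` on partial `L`-functions.** If the value family `m` is `-1` at the
places `v ∉ S` below a `c`-fixed place (inert) and `+1` at those below a `c`-moved place (split) —
the values `ω_{E/F}(ϖ_v)` of the quadratic character of `E/F` at unramified `v`, the accepted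
`quadraticSign` — then `L^S(s, A, As^η ⊗ m) = L^S(s, A, As^{-η})` ("`As⁻(M)` is the twist of
`As⁺(M)` by the quadratic character `ω_{k/k₀}`", Gan–Gross–Prasad §7).
[cite: GanGrossPrasad2012, §7] -/
theorem partialAsaiLTwist_quadraticSign (S : Set (HeightOneSpectrum (𝓞 F))) (c : E ≃ₐ[F] E)
    (A : SatakeFamily E) {m : HeightOneSpectrum (𝓞 F) → ℂ}
    (hinert : ∀ w : HeightOneSpectrum (𝓞 E), w.under (𝓞 F) ∉ S → c • w = w → m (w.under (𝓞 F)) = -1)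
    (hsplit : ∀ w : HeightOneSpectrum (𝓞 E), w.under (𝓞 F) ∉ S → c • w ≠ w → m (w.under (𝓞 F)) = 1)
    (η : ℤˣ) (s : ℂ) :
    partialAsaiLTwist S c A m η s = partialAsaiL S c A (-η) s := by
  unfold partialAsaiL partialAsaiLTwist
  refine tprod_congr fun v => ?_
  have hv : (placeAbove E v.1).under (𝓞 F) ∉ S := by rw [placeAbove_under]; exact v.2
  by_cases hw : c • placeAbove E v.1 = placeAbove E v.1
  · have hm : m v.1 = -1 := by rw [← hinert _ hv hw, placeAbove_under]
    have key := eval_asaiInertPolynomial_units_mul η (-1) (A (placeAbove E v.1))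
      ((v.1.residueCard : ℂ) ^ (-s))
    simp only [Units.val_neg, Units.val_one, Int.cast_neg, Int.cast_one, neg_one_mul] at key
    rw [asaiLocalPolynomial_of_smul_eq A η hw, asaiLocalPolynomial_of_smul_eq A (-η) hw, hm,
      neg_one_mul, key]
  · have hm : m v.1 = 1 := by rw [← hsplit _ hv hw, placeAbove_under]
    rw [hm, one_mul, asaiLocalPolynomial_eq_of_smul_ne A η (-η) hw]

variable [NumberField E]

/-- **Independence of the choice of places above `v`**: for `[E : F] = 2`, `c ≠ 1` and *any*
section `f` of `w ↦ w ∩ 𝓞 F` over the complement of `S`,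
`L^S(s, A, As^η ⊗ m) = ∏'_{v ∉ S} (asaiLocalPolynomial c A η (f v))(m_v q_v^{-s})⁻¹`
(as `partialAsaiL_eq_tprod`). [folklore] -/
theorem partialAsaiLTwist_eq_tprod (h2 : Module.finrank F E = 2) {c : E ≃ₐ[F] E} (hc : c ≠ 1)
    (S : Set (HeightOneSpectrum (𝓞 F))) (A : SatakeFamily E) (m : HeightOneSpectrum (𝓞 F) → ℂ)
    (η : ℤˣ) (s : ℂ) (f : {v : HeightOneSpectrum (𝓞 F) // v ∉ S} → HeightOneSpectrum (𝓞 E))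
    (hf : ∀ v, (f v).under (𝓞 F) = v.1) :
    partialAsaiLTwist S c A m η s = ∏' v : {v : HeightOneSpectrum (𝓞 F) // v ∉ S},
      ((asaiLocalPolynomial c A η (f v)).eval (m v.1 * (v.1.residueCard : ℂ) ^ (-s)))⁻¹ := by
  unfold partialAsaiLTwist
  refine tprod_congr fun v => ?_
  rw [asaiLocalPolynomial_eq_of_under_eq h2 hc A η ((placeAbove_under v.1).trans (hf v).symm)]

end Places

/-! ### Frobenius-value data of a rank-one Artin representation -/

section FrobValues

variable {K : Type*} [Field K] {R : Type*} [CommRing R] [TopologicalSpace R]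

/-- **Frobenius-value datum.** For a rank-one framed Galois representation `μ : Γ_K → GL_1(R)`
(an Artin avatar of a finite-order Hecke character), a set `T` of finite places and a value family
`m : v ↦ m_v ∈ R`: off `T`, `μ` is unramified and every arithmetic Frobenius at every prime above
`v` has characteristic polynomial `X - m_v` (`FramedGaloisRep.HasFrobCharpolyAt`, the tree's
arithmetic convention), i.e. `m_v = μ(Frob_v)`. By Artin reciprocity in Tate's normalisation
(`artinReciprocity_character`) these are the values `ω_μ(ϖ_v)` of the Hecke character of `μ` at
uniformizers. Declared by its absolute name as a dot-notation extension of the accepted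
`FramedGaloisRep` (directory `GaloisRepresentations`). [folklore] -/
def _root_.Literature.NumberTheory.GaloisRepresentations.FramedGaloisRep.IsFrobValueDatum
    (μ : FramedGaloisRep K R 1) (T : Set (HeightOneSpectrum (𝓞 K)))
    (m : HeightOneSpectrum (𝓞 K) → R) : Prop :=
  ∀ v ∉ T, μ.IsUnramifiedAt v ∧ μ.HasFrobCharpolyAt v (X - C (m v))

/-- Unfolding `IsFrobValueDatum`. [folklore] -/
theorem _root_.Literature.NumberTheory.GaloisRepresentations.FramedGaloisRep.isFrobValueDatum_iff
    (μ : FramedGaloisRep K R 1) (T : Set (HeightOneSpectrum (𝓞 K)))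
    (m : HeightOneSpectrum (𝓞 K) → R) :
    μ.IsFrobValueDatum T m ↔ ∀ v ∉ T, μ.IsUnramifiedAt v ∧ μ.HasFrobCharpolyAt v (X - C (m v)) :=
  Iff.rfl

/-- A Frobenius-value datum records unramifiedness off `T`. [folklore] -/
theorem _root_.Literature.NumberTheory.GaloisRepresentations.FramedGaloisRep.IsFrobValueDatum.isUnramifiedAt
    {μ : FramedGaloisRep K R 1} {T : Set (HeightOneSpectrum (𝓞 K))}
    {m : HeightOneSpectrum (𝓞 K) → R} (h : μ.IsFrobValueDatum T m) {v : HeightOneSpectrum (𝓞 K)}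
    (hv : v ∉ T) : μ.IsUnramifiedAt v :=
  (h v hv).1

/-- A Frobenius-value datum records the Frobenius characteristic polynomial `X - m_v` off `T`.
[folklore] -/
theorem _root_.Literature.NumberTheory.GaloisRepresentations.FramedGaloisRep.IsFrobValueDatum.hasFrobCharpolyAt
    {μ : FramedGaloisRep K R 1} {T : Set (HeightOneSpectrum (𝓞 K))}
    {m : HeightOneSpectrum (𝓞 K) → R} (h : μ.IsFrobValueDatum T m) {v : HeightOneSpectrum (𝓞 K)}
    (hv : v ∉ T) : μ.HasFrobCharpolyAt v (X - C (m v)) :=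
  (h v hv).2

/-- Enlarging the exceptional set keeps a Frobenius-value datum. [folklore] -/
theorem _root_.Literature.NumberTheory.GaloisRepresentations.FramedGaloisRep.IsFrobValueDatum.mono
    {μ : FramedGaloisRep K R 1} {T T' : Set (HeightOneSpectrum (𝓞 K))}
    {m : HeightOneSpectrum (𝓞 K) → R} (h : μ.IsFrobValueDatum T m) (hT : T ⊆ T') :
    μ.IsFrobValueDatum T' m :=
  fun v hv => h v fun h' => hv (hT h')

/-- A Frobenius-value datum only sees the values off `T`. [folklore] -/
theorem _root_.Literature.NumberTheory.GaloisRepresentations.FramedGaloisRep.IsFrobValueDatum.congr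
    {μ : FramedGaloisRep K R 1} {T : Set (HeightOneSpectrum (𝓞 K))}
    {m m' : HeightOneSpectrum (𝓞 K) → R} (h : μ.IsFrobValueDatum T m) (hm : ∀ v ∉ T, m v = m' v) :
    μ.IsFrobValueDatum T m' :=
  fun v hv => by rw [← hm v hv]; exact h v hv

variable [NumberField K]

/-- **The Frobenius value at `v ∉ T` is determined**: two Frobenius-value data of `μ` agree off
`T ∪ T'` (there is a prime of `\bar ℤ_K` above `v` and an arithmetic Frobenius at it,
`exists_isArithFrobAt_of_mem_primesAbove_holds`; rank one: `hasFrobCharpolyAt_iff_of_rank_one`).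
[folklore] -/
theorem _root_.Literature.NumberTheory.GaloisRepresentations.FramedGaloisRep.IsFrobValueDatum.apply_eq
    {μ : FramedGaloisRep K R 1} {T T' : Set (HeightOneSpectrum (𝓞 K))}
    {m m' : HeightOneSpectrum (𝓞 K) → R} (h : μ.IsFrobValueDatum T m) (h' : μ.IsFrobValueDatum T' m')
    {v : HeightOneSpectrum (𝓞 K)} (hv : v ∉ T) (hv' : v ∉ T') : m v = m' v := by
  obtain ⟨𝔓, h𝔓⟩ := HeightOneSpectrum.primesAbove_nonempty v
  obtain ⟨Φ, hΦ⟩ := HeightOneSpectrum.exists_isArithFrobAt_of_mem_primesAbove_holds h𝔓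
  have e1 := (FramedGaloisRep.hasFrobCharpolyAt_iff_of_rank_one μ v _).mp (h v hv).2 𝔓 h𝔓 Φ hΦ
  have e2 := (FramedGaloisRep.hasFrobCharpolyAt_iff_of_rank_one μ v _).mp (h' v hv').2 𝔓 h𝔓 Φ hΦ
  exact e1.symm.trans e2

omit [NumberField K] in
/-- **The trivial character has Frobenius values `1`** off any `T` (the `1 × 1` matrix `1` has
characteristic polynomial `X - 1`, and the trivial representation is unramified). [folklore] -/
theorem _root_.Literature.NumberTheory.GaloisRepresentations.FramedGaloisRep.isFrobValueDatum_one
    [NumberField K] (T : Set (HeightOneSpectrum (𝓞 K))) :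
    (1 : FramedGaloisRep K R 1).IsFrobValueDatum T 1 := by
  intro v _
  refine ⟨fun 𝔓 _ σ _ => by simp, ?_⟩
  refine (FramedGaloisRep.hasFrobCharpolyAt_iff_of_rank_one _ v _).mpr fun 𝔓 _ Φ _ => ?_
  simp

/-- For the trivial character, a Frobenius-value datum is `1` off `T`. [folklore] -/
theorem _root_.Literature.NumberTheory.GaloisRepresentations.FramedGaloisRep.IsFrobValueDatum.eq_one_of_one
    {T : Set (HeightOneSpectrum (𝓞 K))} {m : HeightOneSpectrum (𝓞 K) → R}
    (h : (1 : FramedGaloisRep K R 1).IsFrobValueDatum T m) {v : HeightOneSpectrum (𝓞 K)}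
    (hv : v ∉ T) : m v = 1 :=
  h.apply_eq (FramedGaloisRep.isFrobValueDatum_one T) hv hv

end FrobValues

/-! ### Poles at `s = 1` of twisted partial Asai `L`-functions of an automorphic representation -/

section Reps

variable {F E : Type} [Field F] [NumberField F] [Field E] [NumberField E] [Algebra F E]

namespace AutomorphicRepData

variable {N : ℕ} {hcpt : isCompact_glFiniteIntegralLevel N E}
  (π : AutomorphicRepData (AutomorphyDatum.gl N E hcpt))

/-- **`L^S(s, Π, As^η ⊗ μ)` has a (simple) pole at `s = 1`, value currency.** For the character
`μ` of `F^× \ 𝔸_F^×` given by its values `m_v = μ_v(ϖ_v)` off an exceptional set `T` (containing its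
ramification): for every Asai datum `(S, A)` of `π` (`IsAsaiDatum`: `S` finite, Satake parameters
`A` above `v ∉ S`, `c`-fixed places above `v ∉ S` inert) with `T ⊆ S`, the limit
`lim_{s → 1, Re s > 1} (s - 1) L^S(s, Π, As^η ⊗ μ)` exists and is non-zero — the rendering of simple
poles at `s = 1` of the accepted `HasAsaiPole` (Arthur–Clozel Ch. 3 (2.3) for the filter).
Vacuous when no Asai datum contains `T` (e.g. `T` infinite); for `T`, `m` the unramified values
of a genuine unitary `μ` and a genuine `π` the pole does not depend on the datum (finitely many
local factors, finite and non-zero at `s = 1`). For an algebraic Hecke character `χ ‖·‖^{-k}` of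
a totally real `F` use `m_v = χ(ϖ_v) q_v^{k}`. [cite: Flicker1988, p. 296–297] -/
def HasAsaiPoleTwistedBy (c : E ≃ₐ[F] E) (T : Set (HeightOneSpectrum (𝓞 F)))
    (m : HeightOneSpectrum (𝓞 F) → ℂ) (η : ℤˣ) : Prop :=
  ∀ ⦃S : Set (HeightOneSpectrum (𝓞 F))⦄ ⦃A : SatakeFamily E⦄, π.IsAsaiDatum c S A → T ⊆ S →
    ∃ r : ℂ, r ≠ 0 ∧
      Tendsto (fun s => (s - 1) * partialAsaiLTwist S c A m η s) (𝓝[{s : ℂ | 1 < s.re}] 1) (𝓝 r)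

/-- **`L^S(s, Π, As^η ⊗ μ)` has a (simple) pole at `s = 1`, Artin currency** (the requested notion
`HasTwistedAsaiPole π c μ η`). Here `μ : Γ_F → GL_1(ℂ)` is a continuous character (the Artin avatar
of a finite-order Hecke character `ω_μ` of `F`, `ω_μ(ϖ_v) = μ(Frob_v^{arith})`,
`artinReciprocity_character`): for every Asai datum `(S, A)` of `π` and every Frobenius-value
datum `m` of `μ` off `S` (`μ` unramified at `v ∉ S` with `μ.HasFrobCharpolyAt v (X - C (m v))`),
`lim_{s → 1, Re s > 1} (s - 1) L^S(s, Π, As^η ⊗ μ)` exists and is non-zero, where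
`L^S(s, Π, As^η ⊗ μ) = ∏_{v ∉ S} det(1 - m_v As^η(t_v) q_v^{-s})⁻¹` (`partialAsaiLTwist`; written
`L^S(s, Π, As^η × ω_μ⁻¹)` by authors normalising the Artin map through geometric Frobenius).
Equivalent to the value currency over all Frobenius-value data (`hasTwistedAsaiPole_iff`); for
`μ = 1` it is `HasAsaiPole π c η` (`hasTwistedAsaiPole_one_iff`). This is the `L`-function side of
Flicker's dichotomy (1988, Theorem p. 297, stated there for cuspidal `Π` whose central character is
trivial on `𝔸_F^×`, the general case being reduced to it by a twist, p. 296: the partial twisted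
tensor `L`-function has a pole at `s = 1` iff `Π` is `GL_N(𝔸_F)`-distinguished); neither that
theorem nor its `μ`-twisted forms are vendored here — only the predicate.
[cite: Flicker1988, p. 296–297] [cite: GanGrossPrasad2012, §7] -/
def HasTwistedAsaiPole (c : E ≃ₐ[F] E) (μ : FramedGaloisRep F ℂ 1) (η : ℤˣ) : Prop :=
  ∀ ⦃S : Set (HeightOneSpectrum (𝓞 F))⦄ ⦃A : SatakeFamily E⦄ ⦃m : HeightOneSpectrum (𝓞 F) → ℂ⦄,
    π.IsAsaiDatum c S A → μ.IsFrobValueDatum S m →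
      ∃ r : ℂ, r ≠ 0 ∧
        Tendsto (fun s => (s - 1) * partialAsaiLTwist S c A m η s) (𝓝[{s : ℂ | 1 < s.re}] 1) (𝓝 r)

/-- **`L^S(s, Π, As^η ⊗ χ)` has a (simple) pole at `s = 1`, Hecke currency**: for a Hecke character
`χ` of `F` (accepted `HeckeCharacter`), the value currency with `T = χ.ramifiedPlaces` and
`m_v = χ(ϖ_v)` (`HeckeCharacter.valueAtUniformizer`, independent of the uniformizer at unramified
`v`). [cite: Flicker1988, p. 296–297] -/
def HasHeckeTwistedAsaiPole (c : E ≃ₐ[F] E) (χ : HeckeCharacter F) (η : ℤˣ) : Prop :=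
  π.HasAsaiPoleTwistedBy c χ.ramifiedPlaces (fun v => χ.valueAtUniformizer v) η

/-- Unfolding `HasAsaiPoleTwistedBy`. [folklore] -/
theorem hasAsaiPoleTwistedBy_iff (c : E ≃ₐ[F] E) (T : Set (HeightOneSpectrum (𝓞 F)))
    (m : HeightOneSpectrum (𝓞 F) → ℂ) (η : ℤˣ) :
    π.HasAsaiPoleTwistedBy c T m η ↔
      ∀ ⦃S : Set (HeightOneSpectrum (𝓞 F))⦄ ⦃A : SatakeFamily E⦄, π.IsAsaiDatum c S A → T ⊆ S →
        ∃ r : ℂ, r ≠ 0 ∧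
          Tendsto (fun s => (s - 1) * partialAsaiLTwist S c A m η s)
            (𝓝[{s : ℂ | 1 < s.re}] 1) (𝓝 r) :=
  Iff.rfl

/-- Unfolding `HasHeckeTwistedAsaiPole`. [folklore] -/
theorem hasHeckeTwistedAsaiPole_iff (c : E ≃ₐ[F] E) (χ : HeckeCharacter F) (η : ℤˣ) :
    π.HasHeckeTwistedAsaiPole c χ η ↔
      π.HasAsaiPoleTwistedBy c χ.ramifiedPlaces (fun v => χ.valueAtUniformizer v) η :=
  Iff.rfl

/-- `HasAsaiPoleTwistedBy` only sees the values off `T`. [folklore] -/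
theorem hasAsaiPoleTwistedBy_congr (c : E ≃ₐ[F] E) {T : Set (HeightOneSpectrum (𝓞 F))}
    {m m' : HeightOneSpectrum (𝓞 F) → ℂ} (h : ∀ v ∉ T, m v = m' v) (η : ℤˣ) :
    π.HasAsaiPoleTwistedBy c T m η ↔ π.HasAsaiPoleTwistedBy c T m' η := by
  refine forall₂_congr fun S A => forall_congr' fun _ => forall_congr' fun hTS => ?_
  have hm : ∀ v ∉ S, m v = m' v := fun v hv => h v fun h' => hv (hTS h')
  simp_rw [partialAsaiLTwist_congr c A hm]

/-- Enlarging the exceptional set weakens `HasAsaiPoleTwistedBy`. [folklore] -/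
theorem HasAsaiPoleTwistedBy.mono {π : AutomorphicRepData (AutomorphyDatum.gl N E hcpt)}
    {c : E ≃ₐ[F] E} {T T' : Set (HeightOneSpectrum (𝓞 F))} {m : HeightOneSpectrum (𝓞 F) → ℂ}
    {η : ℤˣ} (h : π.HasAsaiPoleTwistedBy c T m η) (hT : T ⊆ T') :
    π.HasAsaiPoleTwistedBy c T' m η :=
  fun _ _ hSA hT'S => h hSA (hT.trans hT'S)

/-- **Artin currency = value currency over Frobenius data**: `π.HasTwistedAsaiPole c μ η` iff for
every exceptional set `T` and every Frobenius-value datum `m` of `μ` off `T`,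
`π.HasAsaiPoleTwistedBy c T m η`. [folklore] -/
theorem hasTwistedAsaiPole_iff (c : E ≃ₐ[F] E) (μ : FramedGaloisRep F ℂ 1) (η : ℤˣ) :
    π.HasTwistedAsaiPole c μ η ↔
      ∀ ⦃T : Set (HeightOneSpectrum (𝓞 F))⦄ ⦃m : HeightOneSpectrum (𝓞 F) → ℂ⦄,
        μ.IsFrobValueDatum T m → π.HasAsaiPoleTwistedBy c T m η :=
  ⟨fun h _ _ hm _ _ hSA hTS => h hSA (hm.mono hTS), fun h _ _ _ hSA hm => h hm hSA subset_rfl⟩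

/-- From the Artin currency to the value currency for one Frobenius-value datum. [folklore] -/
theorem HasTwistedAsaiPole.hasAsaiPoleTwistedBy
    {π : AutomorphicRepData (AutomorphyDatum.gl N E hcpt)} {c : E ≃ₐ[F] E}
    {μ : FramedGaloisRep F ℂ 1} {η : ℤˣ} (h : π.HasTwistedAsaiPole c μ η)
    {T : Set (HeightOneSpectrum (𝓞 F))} {m : HeightOneSpectrum (𝓞 F) → ℂ}
    (hm : μ.IsFrobValueDatum T m) : π.HasAsaiPoleTwistedBy c T m η :=
  (π.hasTwistedAsaiPole_iff c μ η).mp h hm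

/-- **The trivial twist in the value currency**: `m = 1` recovers the accepted `HasAsaiPole`
(restricted to Asai data containing `T`). [folklore] -/
theorem HasAsaiPole.hasAsaiPoleTwistedBy_one {π : AutomorphicRepData (AutomorphyDatum.gl N E hcpt)}
    {c : E ≃ₐ[F] E} {η : ℤˣ} (h : π.HasAsaiPole c η) (T : Set (HeightOneSpectrum (𝓞 F))) :
    π.HasAsaiPoleTwistedBy c T 1 η := by
  intro S A hSA _
  simpa only [partialAsaiLTwist_one] using h hSA

/-- **`μ = 1` recovers `HasAsaiPole`**: the twist by the trivial character `1 : Γ_F → GL_1(ℂ)` has the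
pole iff the untwisted partial Asai `L`-functions do (a Frobenius-value datum of `1` is `1` off `S`,
`IsFrobValueDatum.eq_one_of_one`, by the existence of Frobenius elements). [folklore] -/
theorem hasTwistedAsaiPole_one_iff (c : E ≃ₐ[F] E) (η : ℤˣ) :
    π.HasTwistedAsaiPole c 1 η ↔ π.HasAsaiPole c η := by
  constructor
  · intro h S A hSA
    simpa only [partialAsaiLTwist_one] using h hSA (FramedGaloisRep.isFrobValueDatum_one S)
  · intro h S A m hSA hm
    have hm1 : ∀ v ∉ S, m v = 1 := fun v hv => hm.eq_one_of_one hv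
    simpa only [partialAsaiLTwist_eq_partialAsaiL_of_eq_one c A hm1] using h hSA

/-- **A pole of `As^{-η}` is a pole of `As^η ⊗ ω_{E/F}`**: if the value family `m` is `-1` below the
`c`-fixed and `+1` below the `c`-moved places outside `T` (the unramified values of `ω_{E/F}`), then
`HasAsaiPole π c (-η)` gives `HasAsaiPoleTwistedBy π c T m η` (`partialAsaiLTwist_quadraticSign`;
Gan–Gross–Prasad §7). [cite: GanGrossPrasad2012, §7] -/
theorem HasAsaiPole.hasAsaiPoleTwistedBy_quadraticSign
    {π : AutomorphicRepData (AutomorphyDatum.gl N E hcpt)} {c : E ≃ₐ[F] E} {η : ℤˣ}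
    (h : π.HasAsaiPole c (-η)) {T : Set (HeightOneSpectrum (𝓞 F))} {m : HeightOneSpectrum (𝓞 F) → ℂ}
    (hinert : ∀ w : HeightOneSpectrum (𝓞 E), w.under (𝓞 F) ∉ T → c • w = w → m (w.under (𝓞 F)) = -1)
    (hsplit : ∀ w : HeightOneSpectrum (𝓞 E), w.under (𝓞 F) ∉ T → c • w ≠ w → m (w.under (𝓞 F)) = 1) :
    π.HasAsaiPoleTwistedBy c T m η := by
  intro S A hSA hTS
  have e : ∀ s, partialAsaiLTwist S c A m η s = partialAsaiL S c A (-η) s := fun s =>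
    partialAsaiLTwist_quadraticSign S c A (fun w hw hcw => hinert w (fun h' => hw (hTS h')) hcw)
      (fun w hw hcw => hsplit w (fun h' => hw (hTS h')) hcw) η s
  simpa only [e] using h hSA

/-- **The value currency from a twisted Satake family.** If `t` are scalars at the places of `E`
and `m` the induced value family on `F` (`m_v = t_w` at `c`-fixed, `t_w t_{c • w}` at `c`-moved `w`
above `v ∉ T`), then a simple pole at `s = 1` of the untwisted partial Asai `L`-functions of the
twisted families `w ↦ {t_w αᵢ}` over the Asai data of `π` containing `T` is exactly
`HasAsaiPoleTwistedBy π c T m η` (`partialAsaiL_twist_eq_partialAsaiLTwist`): the pole of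
`L^S(s, Π ⊗ μ̃, As^η)` is the pole of `L^S(s, Π, As^η ⊗ μ̃|_{𝔸_F^×})`. [cite: Flicker1988, p. 296] -/
theorem hasAsaiPoleTwistedBy_iff_twist (c : E ≃ₐ[F] E) (T : Set (HeightOneSpectrum (𝓞 F)))
    (t : HeightOneSpectrum (𝓞 E) → ℂ) {m : HeightOneSpectrum (𝓞 F) → ℂ}
    (hinert : ∀ w : HeightOneSpectrum (𝓞 E), w.under (𝓞 F) ∉ T → c • w = w →
      m (w.under (𝓞 F)) = t w)
    (hsplit : ∀ w : HeightOneSpectrum (𝓞 E), w.under (𝓞 F) ∉ T → c • w ≠ w →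
      m (w.under (𝓞 F)) = t w * t (c • w)) (η : ℤˣ) :
    π.HasAsaiPoleTwistedBy c T m η ↔
      ∀ ⦃S : Set (HeightOneSpectrum (𝓞 F))⦄ ⦃A : SatakeFamily E⦄, π.IsAsaiDatum c S A → T ⊆ S →
        ∃ r : ℂ, r ≠ 0 ∧
          Tendsto (fun s => (s - 1) * partialAsaiL S c (fun w => (A w).map (t w * ·)) η s)
            (𝓝[{s : ℂ | 1 < s.re}] 1) (𝓝 r) := by
  refine forall₂_congr fun S A => forall_congr' fun _ => forall_congr' fun hTS => ?_
  have e : ∀ s, partialAsaiL S c (fun w => (A w).map (t w * ·)) η s = partialAsaiLTwist S c A m η s :=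
    fun s => partialAsaiL_twist_eq_partialAsaiLTwist S c A t
      (fun w hw hcw => hinert w (fun h' => hw (hTS h')) hcw)
      (fun w hw hcw => hsplit w (fun h' => hw (hTS h')) hcw) η s
  simp_rw [e]

end AutomorphicRepData

end Reps

end Literature.NumberTheory.Automorphic
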